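import Summits.AtomisticToContinuum.Crystallization.Theorems.ExcessDecayLiouvilleCoarseGrainsPinSums
import HarnessLib

/-!
# Weighted hcp lattice sums and their kernel evaluator — definitions
(crux `SlackRigidity`, stmt-AtomisticToContinuum-11960, line `ekeland-surgery-parity`,
stub `stub_hcpShapeUniqueMax`: uniqueness of the maximiser of `S₃²/S₆` on `[7/10, 9/10]`)

The uniqueness certificate needs, besides the tree's lattice sums
`hcpSumS e c = ∑_{v ≠ 0} x_v(c)⁻ᵉ` (`x_v(c) = Q v + k²c²`, `…CoarseGrainsPinSums`), their first and
second `c`-derivatives, i.e. the `k²`- and `k⁴`-WEIGHTED sums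
`D_n = ∑ k² x⁻ⁿ⁻¹`, `E_n = ∑ k⁴ x⁻ⁿ⁻²` (`S_n' = −2nc·D_n`, `D_n' = −2(n+1)c·E_n`).  This file only
DEFINES (D-0016: definitions are reviewed; soundness, tails, calculus and the certificate live in
sibling proof files):

* `hcpSumTermW m e c v = [v ≠ 0] (k²)ᵐ · x_v(c)⁻ᵉ` and `hcpSumW m e c = ∑' v, hcpSumTermW m e c v`
  (`hcpSumW 0 e = hcpSumS e`, `D_n = hcpSumW 1 (n+1)`, `E_n = hcpSumW 2 (n+2)`);
* the kernel-evaluable integer floor sum `hcpSumFloorSumW p q K m e M = ∑_{v ∈ [-K,K]³∖0} ⌊M·(k²)ᵐ / N_vᵉ⌋`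
  with the tree's numerator `N_v = hcpSumNumZ p q k i j = 3q²·x_v(p/q)` and the tree's loop shape
  (`hcpSumLoopJ/I/K`), so that `decide +kernel` evaluates it exactly as it does `hcpSumFloorSum`
  (the case `m = 0` is literally `hcpSumFloorSum`).

All `[folklore]` numerics bookkeeping.
-/

noncomputable section

namespace Summit.AtomisticToContinuum.Crystallization.Theorems.EkelandSurgeryParityUniq

open Finset
open Summit.AtomisticToContinuum.Crystallization.Theorems.ExcessDecayLiouvilleCoarseGrains

/-! ## Real side: the weighted sums -/

/-- The weighted general term `[v ≠ 0] (k²)ᵐ (Q v + k²c²)⁻ᵉ` (`m = 0`: the term of `hcpSumS`). [folklore] -/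
def hcpSumTermW (m e : ℕ) (c : ℝ) (v : ℤ × ℤ × ℤ) : ℝ :=
  if v = 0 then 0 else ((v.1 : ℝ) ^ 2) ^ m * ((hcpSumQ v + (v.1 : ℝ) ^ 2 * c ^ 2)⁻¹) ^ e

/-- The weighted lattice sum `∑_{v ≠ 0} (k²)ᵐ x_v(c)⁻ᵉ`: `hcpSumW 1 (n+1) = D_n`, `hcpSumW 2 (n+2) = E_n`,
the `k²`-moments entering `(d/dc) hcpSumS n = −2nc·D_n`, `(d/dc) D_n = −2(n+1)c·E_n`. [folklore] -/
def hcpSumW (m e : ℕ) (c : ℝ) : ℝ := ∑' v, hcpSumTermW m e c v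

/-! ## Integer side: the kernel-evaluable weighted floor sum -/

/-- The integer weight `(k²)ᵐ` of the shifted index `kk` (`k = kk − K`). [folklore] -/
def hcpSumWeightN (K m kk : ℕ) : ℕ := ((((kk : ℤ) - K) ^ 2).toNat) ^ m

/-- Weighted floor term `⌊M·(k²)ᵐ / N^e⌋` (`0` at the origin), indices shifted by `K`. [folklore] -/
def hcpSumFloorTermW (p q K m e M kk ii jj : ℕ) : ℕ :=
  if kk = K ∧ ii = K ∧ jj = K then 0
  else M * hcpSumWeightN K m kk / (hcpSumNumZ p q ((kk : ℤ) - K) ((ii : ℤ) - K) ((jj : ℤ) - K)).toNat ^ e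

/-- Inner loop `∑_{jj < n}` of the weighted floor sum (structural recursion, kernel-evaluable). [folklore] -/
def hcpSumLoopJW (p q K m e M kk ii : ℕ) : ℕ → ℕ
  | 0 => 0
  | n + 1 => hcpSumLoopJW p q K m e M kk ii n + hcpSumFloorTermW p q K m e M kk ii n

/-- Middle loop `∑_{ii < n} ∑_{jj ≤ 2K}`. [folklore] -/
def hcpSumLoopIW (p q K m e M kk : ℕ) : ℕ → ℕ
  | 0 => 0
  | n + 1 => hcpSumLoopIW p q K m e M kk n + hcpSumLoopJW p q K m e M kk n (2 * K + 1)

/-- Outer loop `∑_{kk < n} ∑_{ii ≤ 2K} ∑_{jj ≤ 2K}`. [folklore] -/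
def hcpSumLoopKW (p q K m e M : ℕ) : ℕ → ℕ
  | 0 => 0
  | n + 1 => hcpSumLoopKW p q K m e M n + hcpSumLoopIW p q K m e M n (2 * K + 1)

/-- The weighted floor sum `∑_{v ∈ [-K,K]³ ∖ 0} ⌊M (k²)ᵐ / N_v^e⌋`: a certified lower bound for
`M · ∑ (k²)ᵐ N_v^{-e}` (and an upper bound up to the number of terms). [folklore] -/
def hcpSumFloorSumW (p q K m e M : ℕ) : ℕ := hcpSumLoopKW p q K m e M (2 * K + 1)

/-! ## Sanity -/

/-- Weight `0` is the plain term. [folklore] -/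
theorem hcpSumTermW_zero (e : ℕ) (c : ℝ) (v : ℤ × ℤ × ℤ) : hcpSumTermW 0 e c v = hcpSumTerm e c v := by
  unfold hcpSumTermW hcpSumTerm
  split_ifs <;> simp

/-- Weight `0` is the plain sum `hcpSumS` (anchor: registered sub-goal `hcpSumW_zero` of
stmt-AtomisticToContinuum-11960). [folklore] -/
theorem hcpSumW_zero :
    ∀ (e : ℕ) (c : ℝ), hcpSumW 0 e c = hcpSumS e c := by
  intro e c
  unfold hcpSumW hcpSumS
  exact tsum_congr fun v => hcpSumTermW_zero e c v

/-- The weighted terms are nonnegative. [folklore] -/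
theorem hcpSumTermW_nonneg (m e : ℕ) (c : ℝ) (v : ℤ × ℤ × ℤ) : 0 ≤ hcpSumTermW m e c v := by
  unfold hcpSumTermW
  split_ifs with hv
  · exact le_rfl
  · have := hcpSumQ_nonneg v
    positivity

/-- Kernel spot check of the weighted evaluator on the cube `[-1,1]³` at `c = 1`
(`m = 1`, `e = 1`, `M = 1000`): `∑ ⌊1000 k²/N_v⌋ = 2856` (agrees with the reference script). [folklore] -/
theorem hcpSumFloorSumW_spot : hcpSumFloorSumW 1 1 1 1 1 1000 = 2856 := by
  decide +kernel

/-- Weight `0` of the integer evaluator is literally the tree's `hcpSumFloorSum` (spot check at a grid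
point, `K = 2`). [folklore] -/
theorem hcpSumFloorSumW_zero_spot :
    hcpSumFloorSumW 8165 10000 2 0 3 (10 ^ 20) = hcpSumFloorSum 8165 10000 2 3 (10 ^ 20) := by
  decide +kernel

end Summit.AtomisticToContinuum.Crystallization.Theorems.EkelandSurgeryParityUniq

end
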